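import Summits.ResolutionOfSingularities.ResolutionOfSingularities.Theorems.EquisingularLiftEquisingularLiftNatBlowupChartPointOfPrime
import HarnessLib

/-!
# [OURS · L1 W4.5(b) · EL♮(3)] T-PTPRIME-DICT (4): ONE chart morphism for all primes — comparable primes of a chart algebra give
# SPECIALIZING points of the blowing up, distinct primes give distinct points

Crux chain w45b (cell `res-hironaka`, slot W4.5(b)), working crux **EL♮** = stmt-ResolutionOfSingularities-20038, child **EL♮(3)** =
stmt-ResolutionOfSingularities-20148, route EquisingularLift, line `sections`; dictionary support for res-L1-w45b-stub-4's E-NEG(1) (iv)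
scheme route (3) («two primes `P₁ < P₀` of the chart ring over `𝔪_y` containing `g₁` ⇒ two points `c₁ ⤳ c₀`, `c₁ ≠ c₀`, of the fibre»,
STATUS 2026-08-27T14:40:50Z) — the generic form of the last lines of res-type-100's T-FIBRE (`…NatNonCartierFibre`). HONEST FRAMING: OURS;
Stacks 0804/0805 bookkeeping; NOT a statement of any manuscript; AI-written, weaker than expert review. No `sorry`; standard axioms.
DEF-FREE. `--supports stmt-ResolutionOfSingularities-20148 --as helper`.

WHAT (namespace `…Cruxes.EquisingularLiftNat.Sections`; ANY blowing up `π : X' → X` along `J`):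
* `exists_chartMorphism_presentation` — for `s ∈ X`, generators `c` of `J_s` and a chart index `j` there are a scheme `T`, a morphism
  `g : T → X'` and a map `pt` from the primes of the chart algebra `𝒪_{X,s}[J_s/c_j]` to the points of `T`, MONOTONE for specialization,
  such that for every prime `𝔔` over `𝔪_s` the point `g (pt 𝔔)` lies over `s` and carries a chart-`j` presentation of its local ring at `𝔔`
  (`χ`, `e` as in T-PTPRIME-DICT 1/2 `exists_point_presentation_of_blowupAlgebra_prime`, p521370 — which is this statement one prime at
  a time; the chart morphism `Spec B_j → Proj ≅ X' ×_X Spec 𝒪_{X,s} → X'` does not depend on the prime).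
* **`exists_specializes_ne_of_chartPrime_le`** — two primes `𝔔₁ ≤ 𝔔₀`, `𝔔₁ ≠ 𝔔₀`, of `𝒪_{X,s}[J_s/c_j]` over `𝔪_s` give two points
  `x₁ ⤳ x₀`, `x₁ ≠ x₀`, of `π⁻¹ s`, each with its chart-`j` presentation (distinctness by `chartPrime_eq_of_presentations`, p521370).

References: The Stacks Project, Tags 0804, 0805; p521370 (…NatBlowupChartPointOfPrime), p540294 (…NatBlowupChartPointInjective).
-/

set_option linter.dupNamespace false -- mandated namespace `Summit.<Summit>.<Problem>` of this single-conjunct summit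

noncomputable section

open CategoryTheory CategoryTheory.Limits AlgebraicGeometry TopologicalSpace IsLocalRing HomogeneousLocalization
open Literature.AlgebraicGeometry.Resolution
open AlgebraicGeometry.Scheme.IdealSheafData

namespace Summit.ResolutionOfSingularities.ResolutionOfSingularities.Cruxes.EquisingularLiftNat.Sections

universe u

variable {X' X : Scheme.{u}} {π : X' ⟶ X} {J : X.IdealSheafData}

set_option maxHeartbeats 800000 in
-- the comparison with `Proj` over `Spec 𝒪_{X,s}` elaborates large terms (as in `IsBlowup.exists_chart_morphism`, p521370)
/-- **One chart morphism for all primes.** Let `π : X' → X` be a blowing up along `J`, `s ∈ X`, `c` generators of `J_s`, `j` a chart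
index. There are a scheme `T` (the spectrum of the chart ring), a morphism `g : T → X'` and a map `pt` from the primes of the affine
blowup algebra `𝒪_{X,s}[J_s/c_j]` to `T`, monotone for specialization, such that for every prime `𝔔` over `𝔪_s`: `π (g (pt 𝔔)) = s` and
`𝒪_{X', g (pt 𝔔)}` is presented as the localisation of `𝒪_{X,s}[J_s/c_j]` at `𝔔` by a ring map `χ` extending `π♯` (through
`𝒪_{X,s} ≅ 𝒪_{X,π x'}`), with a ring isomorphism `e : 𝒪_{X',x'} ≅ (𝒪_{X,s}[J_s/c_j])_𝔔`, `e (χ b) = b/1`.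
[cite: StacksProject, Tag 0804; StacksProject, Tag 0805] -/
theorem exists_chartMorphism_presentation (hπ : IsBlowup π J) (s : X) {k : ℕ}
    (c : Fin k → X.presheaf.stalk s) (hc : Ideal.span (Set.range c) = stalkIdeal J s) (j : Fin k) :
    ∃ (T : Scheme.{u}) (g : T ⟶ X') (pt : PrimeSpectrum (blowupAlgebra (Ideal.span (Set.range c)) (c j)) → T),
      (∀ 𝔔₁ 𝔔₀ : PrimeSpectrum (blowupAlgebra (Ideal.span (Set.range c)) (c j)),
        𝔔₁.asIdeal ≤ 𝔔₀.asIdeal → pt 𝔔₁ ⤳ pt 𝔔₀) ∧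
      ∀ 𝔔 : PrimeSpectrum (blowupAlgebra (Ideal.span (Set.range c)) (c j)),
        𝔔.asIdeal.comap (algebraMap _ (blowupAlgebra (Ideal.span (Set.range c)) (c j))) = maximalIdeal (X.presheaf.stalk s) →
        ∃ (x' : X') (_ : x' = g (pt 𝔔)) (hx : π x' = s)
          (χ : blowupAlgebra (Ideal.span (Set.range c)) (c j) →+* X'.presheaf.stalk x')
          (e : X'.presheaf.stalk x' ≃+* Localization.AtPrime 𝔔.asIdeal),
          (∀ a, χ (algebraMap _ _ a) = (π.stalkMap x').hom ((X.presheaf.stalkCongr (.of_eq hx.symm)).hom a)) ∧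
          @IsLocalization.AtPrime _ _ (X'.presheaf.stalk x') _ χ.toAlgebra 𝔔.asIdeal _ ∧
          (∀ b, e (χ b) = algebraMap _ (Localization.AtPrime 𝔔.asIdeal) b) := by
  -- adapted from p521370 `exists_point_presentation_of_blowupAlgebra_prime`: the chart morphism is built BEFORE the prime is fixed
  classical
  have hcj : ∀ j, c j ∈ Ideal.span (Set.range c) := fun j =>
    Ideal.mem_span_range_self (f := c) (x := j)
  haveI : Flat (X.fromSpecStalk s) := flat_fromSpecStalk X s
  have hP : IsBlowup (pullback.snd π (X.fromSpecStalk s))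
      (affineBlowup.idealSheaf (Ideal.span (Set.range c))) := by
    have h := hπ.pullback_snd_of_flat (X.fromSpecStalk s)
    rwa [comap_fromSpecStalk_eq_affineBlowupIdealSheaf, ← hc] at h
  obtain ⟨eP, heP, -⟩ := (affineBlowup.isBlowup (Ideal.span (Set.range c))).unique hP
  set ε : chartRing c j ≃+* blowupAlgebra (Ideal.span (Set.range c)) (c j) :=
    reesChartEquiv (I := Ideal.span (Set.range c)) (c j) (hcj j) with hεdef
  have hε : ∀ a, ε (chartBase c j a) = algebraMap _ (blowupAlgebra (Ideal.span (Set.range c)) (c j)) a :=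
    reesChartEquiv_reesChartBase (c j) _
  -- the chart morphism `q : Spec B_j → Proj ≅ P → X'`
  let q : Spec (.of (chartRing c j)) ⟶ X' :=
    (affineBlowup.chartι (c j) (hcj j) ≫ eP.hom) ≫ pullback.fst π (X.fromSpecStalk s)
  have hqπ : q ≫ π = Spec.map (CommRingCat.ofHom (chartBase c j)) ≫ X.fromSpecStalk s := by
    rw [Category.assoc, pullback.condition, Category.assoc, reassoc_of% heP, ← Category.assoc,
      affineBlowup.chartι_π (c j) (hcj j)]
  -- the point `w 𝔔 = ε⁻¹ 𝔔` of `Spec B_j`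
  let w : PrimeSpectrum (blowupAlgebra (Ideal.span (Set.range c)) (c j)) → Spec (.of (chartRing c j)) := fun 𝔔 =>
    ⟨𝔔.asIdeal.comap (ε : chartRing c j →+* _), Ideal.comap_isPrime (ε : chartRing c j →+* _) 𝔔.asIdeal⟩
  refine ⟨Spec (.of (chartRing c j)), q, w, fun 𝔔₁ 𝔔₀ hle => ?_, fun 𝔔 h𝔔 => ?_⟩
  · exact (PrimeSpectrum.le_iff_specializes (w 𝔔₁) (w 𝔔₀)).mp fun b hb => hle hb
  -- the point of `Spec B_j` (a structure literal, so that membership in its ideal computes)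
  let w' : Spec (.of (chartRing c j)) :=
    ⟨𝔔.asIdeal.comap (ε : chartRing c j →+* _), Ideal.comap_isPrime (ε : chartRing c j →+* _) 𝔔.asIdeal⟩
  have hmemw : ∀ b : chartRing c j, ε b ∈ 𝔔.asIdeal ↔ b ∈ w'.asIdeal := fun b => Iff.rfl
  have hw : (Spec.map (CommRingCat.ofHom (chartBase c j))).base w' = closedPoint (X.presheaf.stalk s) := by
    rw [Spec.map_base]
    change PrimeSpectrum.comap (chartBase c j) w' = closedPoint (X.presheaf.stalk s)
    ext a
    change chartBase c j a ∈ w'.asIdeal ↔ a ∈ (closedPoint (X.presheaf.stalk s)).asIdeal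
    rw [← hmemw, hε, show (closedPoint (X.presheaf.stalk s)).asIdeal = maximalIdeal _ from rfl, ← h𝔔,
      Ideal.mem_comap]
  have hx : π (q w') = s := by
    have h1 : π (q w') = (q ≫ π) w' := (Scheme.Hom.comp_apply q π w').symm
    rw [h1, hqπ, Scheme.Hom.comp_apply, hw, Scheme.fromSpecStalk_closedPoint]
  -- `q` is an isomorphism on local rings at `w 𝔔`
  haveI : IsIso (q.stalkMap w') := by
    have h1 := isIso_stalkMap_pullback_fst_fromSpecStalk π s
      ((affineBlowup.chartι (c j) (hcj j) ≫ eP.hom) w')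
    haveI : IsOpenImmersion (affineBlowup.chartι (c j) (hcj j) ≫ eP.hom) := inferInstance
    have h2 : IsIso ((affineBlowup.chartι (c j) (hcj j) ≫ eP.hom).stalkMap w') := inferInstance
    change IsIso (((affineBlowup.chartι (c j) (hcj j) ≫ eP.hom) ≫ pullback.fst π (X.fromSpecStalk s)).stalkMap w')
    rw [Scheme.Hom.stalkMap_comp]
    exact @IsIso.comp_isIso _ _ _ _ _ _ _ h1 h2
  -- the structure map read at `π x'`
  let ι₁ : X.presheaf.stalk (π (q w')) ⟶ X.presheaf.stalk s := (X.presheaf.stalkCongr (.of_eq hx)).hom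
  let φ' : X.presheaf.stalk (π (q w')) ⟶ CommRingCat.of (chartRing c j) := ι₁ ≫ CommRingCat.ofHom (chartBase c j)
  have hsq : q ≫ π = Spec.map φ' ≫ X.fromSpecStalk (π (q w')) := by
    rw [hqπ, Spec.map_comp, Category.assoc]
    congr 1
    change X.fromSpecStalk s = Spec.map (X.presheaf.stalkCongr (.of_eq hx)).hom ≫ X.fromSpecStalk (π (q w'))
    rw [TopCat.Presheaf.stalkCongr_hom, Scheme.SpecMap_stalkSpecializes_fromSpecStalk]
  obtain ⟨χ₀, h1, hloc, -⟩ := exists_stalk_ringHom_of_chart π (q w') φ' q w' rfl hsq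
  have h1' : ∀ a : X.presheaf.stalk s,
      χ₀ (chartBase c j a) = (π.stalkMap (q w')).hom ((X.presheaf.stalkCongr (.of_eq hx.symm)).hom a) := by
    intro a
    rw [← h1 ((X.presheaf.stalkCongr (.of_eq hx.symm)).hom a)]
    change χ₀ (chartBase c j a) = χ₀ (chartBase c j (ι₁.hom ((X.presheaf.stalkCongr (.of_eq hx.symm)).hom a)))
    rw [show ι₁.hom ((X.presheaf.stalkCongr (.of_eq hx.symm)).hom a) = a from
      stalkCongr_hom_stalkCongr_hom_apply X.presheaf (.of_eq hx.symm) (.of_eq hx) a]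
  -- transport the presentation along `ε`
  have hmem𝔔 : ∀ b, b ∈ 𝔔.asIdeal ↔ ε.symm b ∈ w'.asIdeal := fun b => by
    rw [← hmemw, RingEquiv.apply_symm_apply]
  have hεbase : ∀ a, ε.symm (algebraMap _ (blowupAlgebra (Ideal.span (Set.range c)) (c j)) a) = chartBase c j a := by
    intro a
    rw [← hε, RingEquiv.symm_apply_apply]
  obtain ⟨χ, hχ⟩ : ∃ χ : blowupAlgebra (Ideal.span (Set.range c)) (c j) →+* X'.presheaf.stalk (q w'),
      ∀ b, χ b = χ₀ (ε.symm b) := ⟨χ₀.comp ε.symm.toRingHom, fun b => rfl⟩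
  have hU : ∀ y : w'.asIdeal.primeCompl, IsUnit (χ₀ y) := fun y =>
    @IsLocalization.map_units _ _ w'.asIdeal.primeCompl _ _ χ₀.toAlgebra hloc y
  have hS : ∀ z : X'.presheaf.stalk (q w'), ∃ x : chartRing c j × w'.asIdeal.primeCompl, z * χ₀ x.2 = χ₀ x.1 :=
    fun z => @IsLocalization.surj _ _ w'.asIdeal.primeCompl _ _ χ₀.toAlgebra hloc z
  have hE : ∀ {x y : chartRing c j}, χ₀ x = χ₀ y → ∃ d : w'.asIdeal.primeCompl, (d : chartRing c j) * x = d * y :=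
    fun {x y} h => @IsLocalization.exists_of_eq _ _ w'.asIdeal.primeCompl _ _ χ₀.toAlgebra hloc x y h
  have hLM : 𝔔.asIdeal.primeCompl.IsLocalizationMap (χ : _ → X'.presheaf.stalk (q w')) :=
    { map_units := fun y => by
        have hy' : ε.symm (y : blowupAlgebra (Ideal.span (Set.range c)) (c j)) ∈ w'.asIdeal.primeCompl :=
          fun h => y.2 ((hmem𝔔 _).mpr h)
        have hu := hU ⟨_, hy'⟩
        rwa [← hχ] at hu
      surj := fun z => by
        obtain ⟨⟨x₀, ⟨y₀, hy₀⟩⟩, hz⟩ := hS z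
        have hy : ε y₀ ∈ 𝔔.asIdeal.primeCompl := fun h => hy₀ ((hmemw y₀).mp h)
        refine ⟨⟨ε x₀, ⟨ε y₀, hy⟩⟩, ?_⟩
        have e1 : χ (ε y₀) = χ₀ y₀ := by rw [hχ, RingEquiv.symm_apply_apply]
        have e2 : χ (ε x₀) = χ₀ x₀ := by rw [hχ, RingEquiv.symm_apply_apply]
        simpa only [e1, e2] using hz
      exists_of_eq := fun {x y} hxy => by
        rw [hχ, hχ] at hxy
        obtain ⟨⟨d₀, hd₀⟩, hd⟩ := hE hxy
        have hd' : ε d₀ ∈ 𝔔.asIdeal.primeCompl := fun h => hd₀ ((hmemw d₀).mp h)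
        refine ⟨⟨ε d₀, hd'⟩, ε.symm.injective ?_⟩
        simpa only [map_mul, RingEquiv.symm_apply_apply] using hd }
  letI := χ.toAlgebra
  haveI : IsLocalization.AtPrime (X'.presheaf.stalk (q w')) 𝔔.asIdeal :=
    (isLocalization_iff_isLocalizationMap _ _).mpr hLM
  let e : X'.presheaf.stalk (q w') ≃ₐ[blowupAlgebra (Ideal.span (Set.range c)) (c j)] Localization.AtPrime 𝔔.asIdeal :=
    IsLocalization.algEquiv 𝔔.asIdeal.primeCompl _ _
  refine ⟨q w', rfl, hx, χ, e.toRingEquiv, fun a => ?_, ‹_›, fun b => e.commutes b⟩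
  rw [hχ, hεbase]
  exact h1' a

/-- **Comparable primes give specializing points; distinct primes give distinct points.** Let `π : X' → X` be a blowing up along `J`,
`s ∈ X`, `c` generators of `J_s`, `j` a chart index, and `𝔔₁ ≤ 𝔔₀` two DISTINCT primes of `𝒪_{X,s}[J_s/c_j]` over `𝔪_s`. Then there are
points `x₁ ⤳ x₀`, `x₁ ≠ x₀`, of `π⁻¹ s` whose local rings are the localisations of the chart algebra at `𝔔₁`, `𝔔₀` (with presentations
`χᵢ` extending `π♯`). [cite: StacksProject, Tag 0804] -/
theorem exists_specializes_ne_of_chartPrime_le (hπ : IsBlowup π J) (s : X) {k : ℕ}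
    (c : Fin k → X.presheaf.stalk s) (hc : Ideal.span (Set.range c) = stalkIdeal J s) (j : Fin k)
    (𝔔₁ 𝔔₀ : PrimeSpectrum (blowupAlgebra (Ideal.span (Set.range c)) (c j)))
    (h𝔔₁ : 𝔔₁.asIdeal.comap (algebraMap _ (blowupAlgebra (Ideal.span (Set.range c)) (c j))) = maximalIdeal (X.presheaf.stalk s))
    (h𝔔₀ : 𝔔₀.asIdeal.comap (algebraMap _ (blowupAlgebra (Ideal.span (Set.range c)) (c j))) = maximalIdeal (X.presheaf.stalk s))
    (hle : 𝔔₁.asIdeal ≤ 𝔔₀.asIdeal) (hne : 𝔔₁ ≠ 𝔔₀) :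
    ∃ x₁ x₀ : X', x₁ ⤳ x₀ ∧ x₁ ≠ x₀ ∧
      (∃ (hx : π x₁ = s) (χ : blowupAlgebra (Ideal.span (Set.range c)) (c j) →+* X'.presheaf.stalk x₁)
          (e : X'.presheaf.stalk x₁ ≃+* Localization.AtPrime 𝔔₁.asIdeal),
        (∀ a, χ (algebraMap _ _ a) = (π.stalkMap x₁).hom ((X.presheaf.stalkCongr (.of_eq hx.symm)).hom a)) ∧
        @IsLocalization.AtPrime _ _ (X'.presheaf.stalk x₁) _ χ.toAlgebra 𝔔₁.asIdeal _ ∧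
        (∀ b, e (χ b) = algebraMap _ (Localization.AtPrime 𝔔₁.asIdeal) b)) ∧
      (∃ (hx : π x₀ = s) (χ : blowupAlgebra (Ideal.span (Set.range c)) (c j) →+* X'.presheaf.stalk x₀)
          (e : X'.presheaf.stalk x₀ ≃+* Localization.AtPrime 𝔔₀.asIdeal),
        (∀ a, χ (algebraMap _ _ a) = (π.stalkMap x₀).hom ((X.presheaf.stalkCongr (.of_eq hx.symm)).hom a)) ∧
        @IsLocalization.AtPrime _ _ (X'.presheaf.stalk x₀) _ χ.toAlgebra 𝔔₀.asIdeal _ ∧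
        (∀ b, e (χ b) = algebraMap _ (Localization.AtPrime 𝔔₀.asIdeal) b)) := by
  obtain ⟨T, g, pt, hmono, hpres⟩ := exists_chartMorphism_presentation hπ s c hc j
  obtain ⟨x₁, hpt₁, hx₁, χ₁, e₁, hχ₁, hloc₁, he₁⟩ := hpres 𝔔₁ h𝔔₁
  obtain ⟨x₀, hpt₀, hx₀, χ₀, e₀, hχ₀, hloc₀, he₀⟩ := hpres 𝔔₀ h𝔔₀
  have hsp : x₁ ⤳ x₀ := by
    rw [hpt₁, hpt₀]
    exact (hmono 𝔔₁ 𝔔₀ hle).map g.continuous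
  refine ⟨x₁, x₀, hsp, fun heq => hne ?_, ⟨hx₁, χ₁, e₁, hχ₁, hloc₁, he₁⟩, ⟨hx₀, χ₀, e₀, hχ₀, hloc₀, he₀⟩⟩
  -- same point ⇒ same prime (p521370 `chartPrime_eq_of_presentations`)
  have key : ∀ (y₁ y₀ : X') (hy : y₁ = y₀) (hy₁ : π y₁ = s) (hy₀ : π y₀ = s)
      (ψ₁ : blowupAlgebra (Ideal.span (Set.range c)) (c j) →+* X'.presheaf.stalk y₁)
      (ψ₀ : blowupAlgebra (Ideal.span (Set.range c)) (c j) →+* X'.presheaf.stalk y₀),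
      (∀ a, ψ₁ (algebraMap _ _ a) = (π.stalkMap y₁).hom ((X.presheaf.stalkCongr (.of_eq hy₁.symm)).hom a)) →
      (∀ a, ψ₀ (algebraMap _ _ a) = (π.stalkMap y₀).hom ((X.presheaf.stalkCongr (.of_eq hy₀.symm)).hom a)) →
      @IsLocalization.AtPrime _ _ (X'.presheaf.stalk y₁) _ ψ₁.toAlgebra 𝔔₁.asIdeal _ →
      @IsLocalization.AtPrime _ _ (X'.presheaf.stalk y₀) _ ψ₀.toAlgebra 𝔔₀.asIdeal _ → 𝔔₁ = 𝔔₀ := by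
    intro y₁ y₀ hy hy₁ hy₀ ψ₁ ψ₀ hψ₁ hψ₀ hl₁ hl₀
    subst hy
    exact chartPrime_eq_of_presentations hπ y₁ hy₁ c hc j 𝔔₁ 𝔔₀ ψ₁ ψ₀ hψ₁ hψ₀ hl₁ hl₀
  exact key _ _ heq hx₁ hx₀ χ₁ χ₀ hχ₁ hχ₀ hloc₁ hloc₀

end Summit.ResolutionOfSingularities.ResolutionOfSingularities.Cruxes.EquisingularLiftNat.Sections

end
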